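import Literature.AnabelianGeometry.EtaleTheta.Discharge.Sec5Prop53ThetaOrbit

/-!
# [EtTh] §5, Thm. 5.7 / Prop. 5.3 (v)(vi): an automorphism of `Φ(A_⊚)` that FIXES the divisor of `Θ̈` acts on the chain of
# components as the identity or the reflection — the divisor-geometry half (T2) of the translation-freeness lemma (T-div)
# (pp. 247, 325–327, 330 / PDF pp. 21, 99–101, 104)

Mochizuki, *The étale theta function and its Frobenioid-theoretic manifestations*, Publ. RIMS **45** (2009): Prop. 1.4 (i)
p.247 (PDF p.21) («The zeroes of `Θ̈` on `Ÿ` are precisely the cusps of `Ÿ`; each zero has multiplicity 1.  The divisor of poles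
of `Θ̈` on `Ÿ` is precisely the divisor `D₁`», with p.244 (PDF p.18) «at the irreducible component labeled `j`, the divisor
`D_N` is … the schematic zero locus of `q_X^{j²/2N}`»); Prop. 1.4 (ii) p.247 (the functional equation
`Θ̈(q^{a/2}·Ü) = (−1)^a q^{−a²/2} Ü^{−2a} Θ̈(Ü)` — translation by `a ≠ 0` CHANGES the divisor); Prop. 5.3 (v)/(vi) pp.325–326
(PDF pp.99–100); Thm. 5.7 p.330 (PDF p.104) («… and possible translation by an element of … `l·ℤ`»)
[cite: MochizukiEtTh2009, Prop 1.4 (i) p.247 (PDF p.21); Prop 5.3 (v) p.325 (PDF p.99); Thm 5.7 p.330 (PDF p.104)].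

Cell abc-iut, layer L2, seat abc-iut-L2-d3 (gen 7), row R532 «(T-div)» (junction note J-C5 of abc-iut-L2-d4: «stabiliser of the
theta pole divisor in `(Π_X/Π_Y)·μ₂` is `μ₂` — a statement about `Div(Θ̈^{1/l})` at the model»).  PROOF-ONLY (0 definitions, no
new named fact) over abc-iut-L2-d4's `Discharge/Sec5Prop53ThetaOrbit.lean` (profiles over abc-iut-L6-d1's `DivisorSupportData'`).

THE POINT.  abc-iut-L2-d4's profile calculus shows that a cusp-preserving automorphism `φ` of `Φ(A_⊚)` acting on the labels of
the chain of components by `j ↦ ε·j + c` (Prop. 5.3 (i), (v)) carries an element with non-cuspidal orders `θ(j − t)` to one with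
orders `θ(j − t′)`, `t′ = c + t` (`ε = 1`) resp. `c − t − s` (`ε = −1`) for a profile `θ` symmetric about `s/2` (`profile_gpMap'`).
Here: if `φ` FIXES such an element's non-cuspidal orders — as the anchored divisor transport of a NORMALISED transport does for
the root divisors (this seat's `Sec5Thm57RootDivisorsFixedOfTransport`, (T1)) — and the profile is NOT translation-periodic
(ONE new binder clause `hper : ∀ t, (∀ j, θ (j − t) = θ j) → t = 0`, asserted nowhere; for print's `θ(j) = −j²·ord(q_X)/2` it is
the injectivity of `t ↦ t²` on `t ≥ 0`), then `t′ = t`: **`c = 0` if `ε = 1`, `c = s + 2t` if `ε = −1`** — `φ` acts on the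
chain as the identity or as the reflection about the centre of the element («Stab_{ℤ⋊{±1}}(D₁) = the reflection»).
* `sub_eq_of_profile_not_periodic` — the `ℤ → ℚ` lemma;
* `DivisorSupportData'.ord_gpMap_of_profile'` — the non-cuspidal half of `profile_gpMap'` WITHOUT the cuspidal-orders clause
  (so it applies to the pole part `W₀` as well as to `div(Θ̈)`);
* **`DivisorSupportData'.label_translation_of_ord_gpMap_eq'`** — the statement above;
* **`DivisorSupportData'.label_translation_of_gpMap_divTheta_eq'`** — for `x = div(Θ̈)` (`t = 0`, binder `hdiv` of
  `Sec5Prop53ThetaOrbit`): `φ^gp div(Θ̈) = div(Θ̈)` ⇒ `(ε, c) ∈ {(1, 0), (−1, s)}`;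
* **`psiPhi_labels_id_or_reflection_of_gpMap_divTheta_eq`** — for `φ := Ψ^Φ_{A_⊚}` (`psiPhi 𝔉 Ψ ι e`) with Prop. 5.3 (i) on
  primes (`CuspPreserved`) and (v) (`PreservesNcspLabels`): if `Ψ^Φ_{A_⊚}` fixes `div(Θ̈)` then it acts on the labels
  `Prime^ncsp ⥲ ℤ` by `j ↦ j` or by `j ↦ s − j`.
HONEST FRAMING: implications between predicates on OUR typed divisor data under explicit binders (`hθ`, `hper`, `hdiv` — the
printed description of `div(Θ̈)`, asserted nowhere); nothing here concerns an actual curve; (T1) is the sibling file, (T3) (the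
dictionary with the Galois shadow) is NOT here; typed ≠ discharged; no side taken on anything downstream ([IUTchIII] Cor. 3.12
in particular).
-/

namespace Literature.AnabelianGeometry.EtaleTheta

open CategoryTheory Literature.AlgebraicGeometry.Frobenioids

universe w v v' u u'

namespace FrobenioidThetaDivisors

/-- **Profiles that are not translation-periodic have a well-defined centre**: if `θ(j − t′) = θ(j − t)` for all `j` and no
non-zero translate of `θ` equals `θ`, then `t′ = t`. [cite: MochizukiEtTh2009, Prop 1.4 (ii) p.247 (PDF p.21)] -/
theorem sub_eq_of_profile_not_periodic (θ : ℤ → ℚ) (hper : ∀ t : ℤ, (∀ j, θ (j - t) = θ j) → t = 0) {t t' : ℤ}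
    (h : ∀ j, θ (j - t') = θ (j - t)) : t' = t := by
  have h' : ∀ j, θ (j - (t' - t)) = θ j := fun j => by
    have hj := h (j + t)
    rwa [add_sub_cancel_right, show j + t - t' = j - (t' - t) by ring] at hj
  exact sub_eq_zero.mp (hper _ h')

namespace DivisorSupportData'

variable {C : Type u} [Category.{v} C] {D : Type u'} [Category.{v'} D] {𝔉 : ThetaFrobenioid.{w} C D}
  {𝔓 : DivisorPrimeData 𝔉}

/-- **Transport of the non-cuspidal profile** (abc-iut-L2-d4's `profile_gpMap'`, non-cuspidal half only — no condition on the
cuspidal orders, so it applies to the pole part `W₀` of `div(Θ̈)` as well): if `φ` preserves cuspidality and acts on the labels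
by `j ↦ ε j + c`, an element with non-cuspidal orders `θ(j − t)` (`θ (s − j) = θ j`) is carried to one with non-cuspidal orders
`θ(j − t′)`, `t′ = c + t` (`ε = 1`) resp. `c − t − s` (`ε = −1`). [cite: MochizukiEtTh2009, Prop 5.3 proof p.327 (PDF p.101)] -/
theorem ord_gpMap_of_profile' (𝔖 : DivisorSupportData' 𝔓) (φ : 𝔉.PhiAcirc ≃* 𝔉.PhiAcirc)
    (hφc : ∀ 𝔭, 𝔓.IsCuspidal (Primes.congr φ 𝔭) ↔ 𝔓.IsCuspidal 𝔭) (ε : ℤˣ) (c : ℤ)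
    (hφL : ∀ (𝔭 : Primes 𝔉.PhiAcirc) (h𝔭 : ¬ 𝔓.IsCuspidal 𝔭) (h𝔭' : ¬ 𝔓.IsCuspidal (Primes.congr φ 𝔭)),
      𝔓.ncspEquivZ ⟨Primes.congr φ 𝔭, h𝔭'⟩ = ε * 𝔓.ncspEquivZ ⟨𝔭, h𝔭⟩ + c)
    (θ : ℤ → ℚ) (s : ℤ) (hθ : ∀ j, θ (s - j) = θ j) (x : Algebra.GrothendieckGroup 𝔉.PhiAcirc) (t : ℤ)
    (hx₂ : ∀ (𝔫 : Primes 𝔉.PhiAcirc) (h𝔫 : ¬ 𝔓.IsCuspidal 𝔫),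
      𝔖.ord 𝔫 x = θ (𝔓.ncspEquivZ ⟨𝔫, h𝔫⟩ - t))
    (𝔫 : Primes 𝔉.PhiAcirc) (h𝔫 : ¬ 𝔓.IsCuspidal 𝔫) :
    𝔖.ord 𝔫 (ThetaFrobenioid.gpMap (φ : 𝔉.PhiAcirc →* 𝔉.PhiAcirc) x) =
      θ (𝔓.ncspEquivZ ⟨𝔫, h𝔫⟩ - (if ε = 1 then c + t else c - t - s)) := by
  have hc' := 𝔓.isCuspidal_congr_symm_iff φ hφc
  have hL' := 𝔓.ncspEquivZ_congr_symm φ ε c hφL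
  rw [← MulEquiv.toMonoidHom_eq_coe, ord_gpMap', hx₂ _ ((hc' 𝔫).not.mpr h𝔫), hL' 𝔫 h𝔫 ((hc' 𝔫).not.mpr h𝔫)]
  rcases Int.units_eq_one_or ε with rfl | rfl
  · rw [if_pos rfl, Units.val_one]
    congr 1; ring
  · rw [if_neg (by decide), Units.val_neg, Units.val_one, ← hθ]
    congr 1; ring

/-- **(T2): fixed non-cuspidal orders force translation-freeness of the label action.**  `φ` a cusp-preserving automorphism of
`Φ(A_⊚)` acting on the labels by `j ↦ ε j + c`; `x ∈ Φ(A_⊚)^gp` with non-cuspidal orders `θ(j − t)` for a profile `θ` symmetric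
about `s/2` and NOT translation-periodic (`hper`).  If `φ^gp` fixes the non-cuspidal orders of `x` (`hfix`; e.g. `φ^gp x = x`),
then `c = 0` when `ε = 1`, and `c = s + 2t` when `ε = −1` — `φ` acts on the chain of components as the identity or as the
reflection about the centre `t + s/2` of `x` («the stabiliser of the theta divisor in `ℤ ⋊ {±1}` is the reflection»; translation by
`a ≠ 0` changes `div(Θ̈)` by `div(q^{−a²/2}U^{−2a})`, Prop. 1.4 (ii)).
[cite: MochizukiEtTh2009, Prop 1.4 (ii) p.247 (PDF p.21); Prop 5.3 (v) p.325 (PDF p.99); Thm 5.7 p.330 (PDF p.104)] -/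
theorem label_translation_of_ord_gpMap_eq' (𝔖 : DivisorSupportData' 𝔓) (φ : 𝔉.PhiAcirc ≃* 𝔉.PhiAcirc)
    (hφc : ∀ 𝔭, 𝔓.IsCuspidal (Primes.congr φ 𝔭) ↔ 𝔓.IsCuspidal 𝔭) (ε : ℤˣ) (c : ℤ)
    (hφL : ∀ (𝔭 : Primes 𝔉.PhiAcirc) (h𝔭 : ¬ 𝔓.IsCuspidal 𝔭) (h𝔭' : ¬ 𝔓.IsCuspidal (Primes.congr φ 𝔭)),
      𝔓.ncspEquivZ ⟨Primes.congr φ 𝔭, h𝔭'⟩ = ε * 𝔓.ncspEquivZ ⟨𝔭, h𝔭⟩ + c)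
    (θ : ℤ → ℚ) (s : ℤ) (hθ : ∀ j, θ (s - j) = θ j) (hper : ∀ t : ℤ, (∀ j, θ (j - t) = θ j) → t = 0)
    (x : Algebra.GrothendieckGroup 𝔉.PhiAcirc) (t : ℤ)
    (hx₂ : ∀ (𝔫 : Primes 𝔉.PhiAcirc) (h𝔫 : ¬ 𝔓.IsCuspidal 𝔫),
      𝔖.ord 𝔫 x = θ (𝔓.ncspEquivZ ⟨𝔫, h𝔫⟩ - t))
    (hfix : ∀ (𝔫 : Primes 𝔉.PhiAcirc), ¬ 𝔓.IsCuspidal 𝔫 →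
      𝔖.ord 𝔫 (ThetaFrobenioid.gpMap (φ : 𝔉.PhiAcirc →* 𝔉.PhiAcirc) x) = 𝔖.ord 𝔫 x) :
    (ε = 1 ∧ c = 0) ∨ (ε = -1 ∧ c = s + 2 * t) := by
  -- the transported profile has centre `t′`; fixedness gives `θ(j − t′) = θ(j − t)` at every label `j`
  have h : ∀ j : ℤ, θ (j - (if ε = 1 then c + t else c - t - s)) = θ (j - t) := by
    intro j
    set q := 𝔓.ncspEquivZ.symm j with hq
    have hj : 𝔓.ncspEquivZ ⟨q.1, q.2⟩ = j := by
      rw [Subtype.coe_eta, hq, Equiv.apply_symm_apply]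
    have h1 := 𝔖.ord_gpMap_of_profile' φ hφc ε c hφL θ s hθ x t hx₂ q.1 q.2
    rw [hfix q.1 q.2, hx₂ q.1 q.2, hj] at h1
    exact h1.symm
  have ht := sub_eq_of_profile_not_periodic θ hper h
  rcases Int.units_eq_one_or ε with rfl | rfl
  · rw [if_pos rfl] at ht
    exact Or.inl ⟨rfl, by omega⟩
  · rw [if_neg (by decide)] at ht
    exact Or.inr ⟨rfl, by omega⟩

/-- **(T2) for `div(Θ̈)` itself** (`t = 0`; binder `hdiv` = «the description of the divisor of zeroes and poles of `Θ̈` in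
Proposition 1.4, (i)» as in abc-iut-L2-d4's `Sec5Prop53ThetaOrbit`, plus `hper`): a cusp-preserving, label-affine `(ε, c)`
automorphism `φ` of `Φ(A_⊚)` with `φ^gp div(Θ̈) = div(Θ̈)` has `(ε, c) = (1, 0)` or `(−1, s)`.
[cite: MochizukiEtTh2009, Prop 1.4 (i) p.247 (PDF p.21); Prop 5.3 (vi) p.326 (PDF p.100); Thm 5.7 p.330 (PDF p.104)] -/
theorem label_translation_of_gpMap_divTheta_eq' (𝔖 : DivisorSupportData' 𝔓) (φ : 𝔉.PhiAcirc ≃* 𝔉.PhiAcirc)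
    (hφc : ∀ 𝔭, 𝔓.IsCuspidal (Primes.congr φ 𝔭) ↔ 𝔓.IsCuspidal 𝔭) (ε : ℤˣ) (c : ℤ)
    (hφL : ∀ (𝔭 : Primes 𝔉.PhiAcirc) (h𝔭 : ¬ 𝔓.IsCuspidal 𝔭) (h𝔭' : ¬ 𝔓.IsCuspidal (Primes.congr φ 𝔭)),
      𝔓.ncspEquivZ ⟨Primes.congr φ 𝔭, h𝔭'⟩ = ε * 𝔓.ncspEquivZ ⟨𝔭, h𝔭⟩ + c)
    (θ : ℤ → ℚ) (s : ℤ) (hθ : ∀ j, θ (s - j) = θ j) (hper : ∀ t : ℤ, (∀ j, θ (j - t) = θ j) → t = 0)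
    (hdiv : ∀ (𝔫 : Primes 𝔉.PhiAcirc) (h𝔫 : ¬ 𝔓.IsCuspidal 𝔫),
      𝔖.ord 𝔫 𝔓.divTheta = θ (𝔓.ncspEquivZ ⟨𝔫, h𝔫⟩))
    (hfix : ThetaFrobenioid.gpMap (φ : 𝔉.PhiAcirc →* 𝔉.PhiAcirc) 𝔓.divTheta = 𝔓.divTheta) :
    (ε = 1 ∧ c = 0) ∨ (ε = -1 ∧ c = s) := by
  have h0 : ∀ (𝔫 : Primes 𝔉.PhiAcirc) (h𝔫 : ¬ 𝔓.IsCuspidal 𝔫),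
      𝔖.ord 𝔫 𝔓.divTheta = θ (𝔓.ncspEquivZ ⟨𝔫, h𝔫⟩ - 0) := fun 𝔫 h𝔫 => by
    rw [sub_zero]; exact hdiv 𝔫 h𝔫
  have h := 𝔖.label_translation_of_ord_gpMap_eq' φ hφc ε c hφL θ s hθ hper 𝔓.divTheta 0 h0
    (fun 𝔫 _ => by rw [hfix])
  rw [mul_zero, add_zero] at h
  exact h

end DivisorSupportData'

/-! ### For `Ψ^Φ_{A_⊚}` (Prop. 5.3 (i) on primes and (v) as typed) -/

section PsiPhi

variable {C : Type u} [Category.{v} C] {D : Type u'} [Category.{v'} D] {𝔉 : ThetaFrobenioid.{w} C D}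
  {𝔓 : DivisorPrimeData 𝔉} (Ψ : C ≌ C) (ι : Ψ.functor.obj 𝔉.Acirc ≅ 𝔉.Acirc)
  (e : 𝔉.PhiAcirc ≃* 𝔉.pre.Mon (𝔉.base.obj (Ψ.functor.obj 𝔉.Acirc)))

/-- **`Ψ^Φ_{A_⊚}` acts on the chain of components as the identity or the reflection when it fixes `div(Θ̈)`.**  With Prop. 5.3
(i) on primes (`hc : CuspPreserved`) and (v) (`hL : PreservesNcspLabels` — SOME affine label action), the printed description of
`div(Θ̈)` (`hdiv`, profile `θ` symmetric about `s/2`) and `hper`: if `(Ψ^Φ_{A_⊚})^gp div(Θ̈) = div(Θ̈)` for the anchor `ι`, then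
`Ψ^Φ_{A_⊚}` acts on the labels by `j ↦ j` or by `j ↦ s − j` — NO translation.  (For a normalised transport this fixedness is
supplied at `A_N` by (T1) `exists_psiPhiN_fixes_rootPair_of_transport` and descends to `A_⊚` along `φ : A_N → A_⊚` by the
naturality of `Ψ^Φ`.) [cite: MochizukiEtTh2009, Prop 5.3 (v) p.325 (PDF p.99); Thm 5.7 p.330 (PDF p.104)] -/
theorem psiPhi_labels_id_or_reflection_of_gpMap_divTheta_eq (𝔖 : DivisorSupportData' 𝔓) (hc : CuspPreserved 𝔓 Ψ ι e)
    (hL : PreservesNcspLabels 𝔓 Ψ ι e hc) (θ : ℤ → ℚ) (s : ℤ) (hθ : ∀ j, θ (s - j) = θ j)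
    (hper : ∀ t : ℤ, (∀ j, θ (j - t) = θ j) → t = 0)
    (hdiv : ∀ (𝔫 : Primes 𝔉.PhiAcirc) (h𝔫 : ¬ 𝔓.IsCuspidal 𝔫),
      𝔖.ord 𝔫 𝔓.divTheta = θ (𝔓.ncspEquivZ ⟨𝔫, h𝔫⟩))
    (hfix : ThetaFrobenioid.gpMap (psiPhi 𝔉 Ψ ι e : 𝔉.PhiAcirc →* 𝔉.PhiAcirc) 𝔓.divTheta = 𝔓.divTheta) :
    (∀ (𝔭 : Primes 𝔉.PhiAcirc) (h𝔭 : ¬ 𝔓.IsCuspidal 𝔭),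
        𝔓.ncspEquivZ ⟨Primes.congr (psiPhi 𝔉 Ψ ι e) 𝔭, fun h => h𝔭 ((hc 𝔭).mp h)⟩ = 𝔓.ncspEquivZ ⟨𝔭, h𝔭⟩) ∨
      ∀ (𝔭 : Primes 𝔉.PhiAcirc) (h𝔭 : ¬ 𝔓.IsCuspidal 𝔭),
        𝔓.ncspEquivZ ⟨Primes.congr (psiPhi 𝔉 Ψ ι e) 𝔭, fun h => h𝔭 ((hc 𝔭).mp h)⟩ = s - 𝔓.ncspEquivZ ⟨𝔭, h𝔭⟩ := by
  obtain ⟨ε, c, hLab⟩ := hL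
  have hLab' : ∀ (𝔭 : Primes 𝔉.PhiAcirc) (h𝔭 : ¬ 𝔓.IsCuspidal 𝔭)
      (h𝔭' : ¬ 𝔓.IsCuspidal (Primes.congr (psiPhi 𝔉 Ψ ι e) 𝔭)),
      𝔓.ncspEquivZ ⟨Primes.congr (psiPhi 𝔉 Ψ ι e) 𝔭, h𝔭'⟩ = ε * 𝔓.ncspEquivZ ⟨𝔭, h𝔭⟩ + c := fun 𝔭 h𝔭 _ => hLab 𝔭 h𝔭
  rcases 𝔖.label_translation_of_gpMap_divTheta_eq' (psiPhi 𝔉 Ψ ι e) hc ε c hLab' θ s hθ hper hdiv hfix with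
    ⟨rfl, rfl⟩ | ⟨rfl, rfl⟩
  · refine Or.inl fun 𝔭 h𝔭 => ?_
    rw [hLab 𝔭 h𝔭, Units.val_one, one_mul, add_zero]
  · refine Or.inr fun 𝔭 h𝔭 => ?_
    rw [hLab 𝔭 h𝔭, Units.val_neg, Units.val_one]
    ring

end PsiPhi

end FrobenioidThetaDivisors

end Literature.AnabelianGeometry.EtaleTheta
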